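import Summits.QuantumFields.YangMills.Theorems.BalabanUVNodesK0Beta13RadiusBlindGuarded

/-!
# K0 — RADIUS ∕ CUTOFF BLINDNESS OF def-B's χ-GENERIC β `betaOfRecord₈Tχ` MODULO A GUARDED READ SET: the β-level statement of ✓p796168 §1 for ANY χ-slot record
# (director-ym №467 (ii): the Ax ∕ Chi re-issue is «L-gen by χ-slot» — `betaOfRecord₁₃Chi χ θ := betaOfRecord₈Tχ F N (TβOfRecord₁₃ F N) χ θ.toStage8Params`, `betaOfRecord₁₃Ax θ :=` the instance at
# `chiβOfRecord₁₃Ax θ`; this file's theorem is stated on that type NOW, so the Ax ∕ Chi members inherit ✓p796168 without a re-proof)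

Cell `pub-ymgap`, width seat `pub-ymgap-dag-n07-w3` (g21; N07 [B11] ∕ K0 junction).  `--kind proof --supports stmt-QuantumFields-20541 --as helper`, COUNT-NEUTRAL.  NEW leaf; theorems only —
0 `def`, 0 `sorry`, 0 `instance`, 0 `notation`.  Imports ONLY this seat's `…K0Beta13RadiusBlindGuarded` (✓p796168).  [I] = [Balaban1987RG1]; [III] = [Balaban1988Convergent].

CONTENT.  ★★★ `betaOfRecord₈Tχ_Tcan_eq_of_readSet_guarded` — for ONE Stage-8 parameter tuple `θ` (direction space, chart `ρ8`, basis `bV`, base histories `v₀`, level `γ`, background radius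
`θ.εbg`), two cutoff families `χ, χ′` (the χ-SLOT of def-B's `betaOfRecord₈Tχ`, [III] (2.17)∕[I] (2.9) species — ANY centre) and a second background radius `ε′`:
`betaOfRecord₈Tχ F N (TcanOfRecord F N) χ θ = betaOfRecord₈Tχ F N (TcanOfRecord F N) χ′ {θ with εbg := ε′}` under the GUARDED read-set rows of ✓p796168 §1 on an open domain system
`U K k ∋ 1` (guard `G` antitone in the level, eventually true in the torus index `K`): cutoff agreement (hχ), collar (hN), continuity (hC), selector agreement `U_{k+1}(θ.εbg; W) = U_{k+1}(ε′; W)`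
(hbg), nesting (hB).  Proof = ✓p796168's `betaMerged_Tcan_eq_of_readSet_guarded` + `Node00.betaOfMerged_congr_at ∕ beta0OfMerged_congr_at` (the two lines g19 used at the θ₁₃ᶜᶜᴹᵂᶻᴮ members).
The choice-centred member statement ✓p796168 `betaOfRecord₁₃_thm1CCMWZB_radiusBlind_of_readSet_guarded` is the instance `χ := chiFixed29 … ν(a) …`, `χ′ := chiFixed29 … ν(a′) …` (there (hχ) is
DERIVED from (hbg) by `chiFixed29_congr_of_Uk_eq`, a property of the choice-centred cutoff; for an Ax cutoff the analogous congruence is its owner's one lemma).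

HONEST FRAMING (binding).  Kernel bookkeeping; NO β estimate; nothing of Bałaban's asserted or discharged; every row is a displayed hypothesis; defines nothing; touches no body of record
(BODY-FREEZE №460 honoured); K0⁷ (aside-bound per №467) ∕ K0ᴬ NOT closed; N07 NOT discharged; COUNT 8∕28 · K 1∕4 UNMOVED; R4 = the CONDITIONAL finite-𝕋⁴ rung `BalabanLadder.UV` at
fixed `ε = L^(−K)` only — NOT continuum ∕ ℝ⁴ ∕ OS; the Yang–Mills mass gap (Clay) is NOT proved by any of this.  Standard axioms only.
-/

noncomputable section

open MeasureTheory Set Filter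
open scoped Matrix.Norms.L2Operator

namespace Summit.QuantumFields.YangMills.BalabanUVNodes.K0BetaChiRadiusBlindGuarded

open _root_.Topology
open Literature.MathematicalPhysics.QuantumFieldTheory.Balaban1983to89
open Literature.MathematicalPhysics.QuantumFieldTheory.Balaban1983to89.Node00
open Literature.MathematicalPhysics.QuantumFieldTheory.Balaban1983to89.T4Continuum (T4Family)
open B12Eq019ActionBody (integrand)
open Summit.QuantumFields.YangMills.BalabanUVNodes.K0Beta13RadiusBlindGuarded (betaMerged_Tcan_eq_of_readSet_guarded)

variable (F : T4Family) (N : ℕ) [NeZero N]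

/-- ★★★ **RADIUS ∕ CUTOFF BLINDNESS OF THE χ-GENERIC β OF RECORD, GUARDED READ SET.**  def-B's `betaOfRecord₈Tχ F N T χ θ` ([I] (1.20)–(1.22) on the merged term (1.6), χ-slot generic)
at the canonical-version transport `T := TcanOfRecord F N` takes THE SAME VALUE at `(χ, θ)` and at `(χ′, {θ with εbg := ε′})` whenever, on an open domain system `U K k ∋ 1` and at the pairs
of a level guard `G` (antitone in the level, eventually true in `K`): (hχ) the two cutoffs agree at fields whose average lies in `U K (k+1)`; (hN) such a field at which `χ` is non-zero lies in
`U K k`; (hC) the transform of the level-`k` `χ`-density is regular on `U K (k+1)`; (hbg) the background selectors at the two radii agree on `U K (k+1)`; (hB) the averaged background of a field of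
`U K (k+1)` lies in `U K k`.  (β reads the merged terms only on the tori `K → ∞`: `polLimit = limUnder atTop`.)  CONDITIONAL on the displayed rows; NO β estimate; nothing of Bałaban's asserted.
[cite: Balaban1987RG1, (1.20)–(1.22) p.264, (1.21) «T^{(j+1)} ↗ Z^d», (1.6) p.261, (0.19) p.255, (0.21) p.256, p.259, (2.9) p.266; Balaban1988Convergent, (2.17) p.257, p.265 (bookkeeping)] -/
theorem betaOfRecord₈Tχ_Tcan_eq_of_readSet_guarded (θ : Stage8Params F N)
    (χ χ' : (K : ℕ) → (ℕ → ℝ) → (k : ℕ) → Density (F.P K) k (Node00.SU N)) (ε' : ℝ)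
    (G : ℕ → ℕ → Prop) (hmono : ∀ K k, G K (k + 1) → G K k) (hev : ∀ k, ∀ᶠ K in atTop, G K k)
    (U : (K k : ℕ) → Set (GaugeField (F.P K) k (Node00.SU N))) (hUo : ∀ K k, G K k → IsOpen (U K k))
    (hU1 : ∀ K k, G K k → (1 : GaugeField (F.P K) k (Node00.SU N)) ∈ U K k)
    (hχ : ∀ K (g : ℕ → ℝ) k V, k < K → G K (k + 1) → (avOfRecord F N K k).avg V ∈ U K (k + 1) → χ K g k V = χ' K g k V)
    (hN : ∀ K (g : ℕ → ℝ) k V, k < K → G K (k + 1) → (avOfRecord F N K k).avg V ∈ U K (k + 1) → χ K g k V ≠ 0 → V ∈ U K k)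
    (hC : ∀ K (g : ℕ → ℝ) k, k < K → G K (k + 1) → U K (k + 1) ⊆ regSetOfRecord F N K k
      (integrand (χ K g k) (gfOfRecord F N K k) (g k) (effActionHT F N (TcanOfRecord F N) χ K g k)))
    (hbg : ∀ K k W, k < K → G K (k + 1) → W ∈ U K (k + 1) → Uk F N K (k + 1) θ.εbg W = Uk F N K (k + 1) ε' W)
    (hB : ∀ K k W, k < K → G K (k + 1) → W ∈ U K (k + 1) → Averaging.iter (avOfRecord F N K) k (Uk F N K (k + 1) θ.εbg W) ∈ U K k) :
    betaOfRecord₈Tχ F N (TcanOfRecord F N) χ θ = betaOfRecord₈Tχ F N (TcanOfRecord F N) χ' { θ with εbg := ε' } := by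
  letI := θ.instVβ₁; letI := θ.instVβ₂; letI := θ.instιβ
  have hm : betaMerged F (mergedTermFamilyMatT F N (TcanOfRecord F N) χ θ.εbg) θ.ρ8 θ.bV =
      betaMerged F (mergedTermFamilyMatT F N (TcanOfRecord F N) χ' ε') θ.ρ8 θ.bV :=
    betaMerged_Tcan_eq_of_readSet_guarded θ.ρ8 θ.bV χ χ' θ.εbg ε' G hmono hev U hUo hU1 hχ hN hC hbg hB
  funext k
  exact betaOfMerged_congr_at θ.γ (congrFun hm k) (beta0OfMerged_congr_at θ.v₀ (congrFun hm k))

/-- **The same with an UNGUARDED domain system** (every pair `(K, k)`; guard `G := ⊤`) — the shape g19's ✓p785962 consumers use. [cite: Balaban1987RG1, (1.20)–(1.22) p.264 (bookkeeping)] -/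
theorem betaOfRecord₈Tχ_Tcan_eq_of_readSet (θ : Stage8Params F N)
    (χ χ' : (K : ℕ) → (ℕ → ℝ) → (k : ℕ) → Density (F.P K) k (Node00.SU N)) (ε' : ℝ)
    (U : (K k : ℕ) → Set (GaugeField (F.P K) k (Node00.SU N))) (hUo : ∀ K k, IsOpen (U K k)) (hU1 : ∀ K k, (1 : GaugeField (F.P K) k (Node00.SU N)) ∈ U K k)
    (hχ : ∀ K (g : ℕ → ℝ) k V, k < K → (avOfRecord F N K k).avg V ∈ U K (k + 1) → χ K g k V = χ' K g k V)
    (hN : ∀ K (g : ℕ → ℝ) k V, k < K → (avOfRecord F N K k).avg V ∈ U K (k + 1) → χ K g k V ≠ 0 → V ∈ U K k)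
    (hC : ∀ K (g : ℕ → ℝ) k, k < K → U K (k + 1) ⊆ regSetOfRecord F N K k
      (integrand (χ K g k) (gfOfRecord F N K k) (g k) (effActionHT F N (TcanOfRecord F N) χ K g k)))
    (hbg : ∀ K k W, k < K → W ∈ U K (k + 1) → Uk F N K (k + 1) θ.εbg W = Uk F N K (k + 1) ε' W)
    (hB : ∀ K k W, k < K → W ∈ U K (k + 1) → Averaging.iter (avOfRecord F N K) k (Uk F N K (k + 1) θ.εbg W) ∈ U K k) :
    betaOfRecord₈Tχ F N (TcanOfRecord F N) χ θ = betaOfRecord₈Tχ F N (TcanOfRecord F N) χ' { θ with εbg := ε' } :=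
  betaOfRecord₈Tχ_Tcan_eq_of_readSet_guarded F N θ χ χ' ε' (fun _ _ => True) (fun _ _ _ => trivial) (fun _ => Filter.Eventually.of_forall fun _ => trivial) U
    (fun K k _ => hUo K k) (fun K k _ => hU1 K k) (fun K g k V hk _ => hχ K g k V hk) (fun K g k V hk _ => hN K g k V hk) (fun K g k hk _ => hC K g k hk)
    (fun K k W hk _ => hbg K k W hk) (fun K k W hk _ => hB K k W hk)

end Summit.QuantumFields.YangMills.BalabanUVNodes.K0BetaChiRadiusBlindGuarded
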